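import Summits.BirchSwinnertonDyer.Rank1Residual.Additive.WildThreeDivisibilitySuffices
import Summits.BirchSwinnertonDyer.Rank1Residual.AdditivePotMult.RankZeroIndexBound
import Summits.BirchSwinnertonDyer.Rank1Residual.X11b.TwistTransportIrr
import Literature.NumberTheory.EllipticCurves.Rank1Residual.Typed.SelmerCardCertificateRankZero
import Literature.NumberTheory.EllipticCurves.NonEisensteinPrimeOfSurjective
import HarnessLib

/-!
# O6/O5 rank one: the INDIVISIBILITY half `T1⁻` of the refined Kolyvagin conjecture at an additive
# `3`, AT THE PAIR, from ONE `3`-descent certificate on the Heegner TWIST (cell `b2b-bsdres`, team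
# o5o6, seat O6 planner 2 = `b2b-bsdres-o6-r2`, gen 36; BOOKKEEPING over the tree's predicates;
# nothing asserted about curves, nothing booked)

HONEST FRAMING (cell `b2b-bsdres`, verbatim): research routes; no claim beyond stated classes;
census output = EVIDENCE / conjecture items, never a Literature fact. This file adds NO conjecture
and NO Literature fact; every deep input is a HYPOTHESIS: the structure-theorem SHAPE
`KolyvaginStructureThreeShape` (gen 1, `WildThreeRefinedKolyvagin`: `ord₃ #Ш(E/K) + 2·M_∞ = 2·ord₃
[E(K):ℤP]`, FLAGGED there for the `p ∣ N` reading), Cassels–Tate (`hCT`) and Gross–Zagier–Kolyvagin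
(`hGZK`).

Gen 4 (`WildThreeDivisibilitySuffices`) recorded that, granted the structure shape, the
indivisibility half `T1⁻` (`RKC3Indivisibility`: `¬ M_∞ ≥ t + 1`, `t = ord₃ ∏_q c_q(E)`) on a LOCKED
pair is "a per-pair DESCENT certificate (`#Sel₃`, `#Sel₉` lower bounds)"
(`minftyEq_of_structure_of_minftyGe_of_shaLower`, hypothesis `hlow : 2·ord₃[E(K):ℤP] ≤ ord₃ #Ш(E/K)
+ 2t`). This file names the certificate that the gen-36 census actually produced and shows it
suffices WITHOUT `#Sel₉` and WITHOUT the divisibility half: ONE exact `3`-Selmer element on a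
`ℚ`-model `Wd` of the rank-`0` twist `E^{(d_K)}` (`#Sel₃(Wd/ℚ) > 1`; `Wd[3]` irreducible,
transported from `ρ̄_{E,3}` onto; `rank Wd(ℚ) = 0` by `hGZK`) gives `3 ∣ #Ш(Wd)`, Cassels–Tate makes
it `9 ∣ #Ш(Wd)`, the odd-part decomposition `ord₃ #Ш(E/K) = ord₃ #Ш(E) + ord₃ #Ш(E^{(d_K)})` (tree
`AdditivePotMult.padicValNat_shaOrder_baseChange`) gives `ord₃ #Ш(E/K) ≥ 2` (§1), and then the
structure shape with the census index bound `ord₃ [E(K):ℤP] ≤ t + 1` forces `M_∞ ≤ t`, i.e. `T1⁻` AT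
THE PAIR (§2). With the divisibility half `T1⁺` at the pair (`M_∞ ≥ t`, the ONLY class-level input
of slot 2) and the census equality `ord₃ [E(K):ℤP] = t + 1` one gets `M_∞ = t`, `Ш(E)[3^∞] = 0`,
`ord₃ #Ш(E^{(d_K)}) = 2` and — given the analytic values — `BSD(E,3)` and `BSD(E^{(d_K)},3)` with NO
rank-`0` Iwasawa input for the twist (§3).

EVIDENCE, NOT INPUT (kit j228009 / j228010 / j228100, prereg PREREG-G36-1 sha256 8039d33f…; engine =
x11b's Schaefer–Stoll `3`-descent `desc3lib.gp` rev h1 + verifier `verify3.gp` rev 2,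
byte-identical): on ALL `122` locked pairs of the o5o6 rank-one census (`79` with `t = 0`, `43` with
`t ≥ 1`; `59` wild) the twist certificate holds with TWO exact elements (verifier `437/437` pass),
and `TowerSurjThree` is CERTIFIED on all `195` rows (gen36/surj9: `GL₂(ℤ/9)` subgroup enumeration +
a Frobenius witness; no 9-deficient curve), so — granted the structure shape — `T1⁻` holds at every
locked pair; it is automatic at the `315` unlocked ones
(`indexIdentity_of_structure_of_minftyGe_of_unlocked`). The twists lie beyond the census conductor
window; nothing is booked.

References: [McCallumLMS1991] Thm. 5.4, 5.8; [WZhang2014] §3.8, Thm. 10.2; [Jetchev2008] Conj. 1.3;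
[GrossLMS1991] Prop. 6.2; [DokchitserDokchitserAnnals2010] Lemma 4.14; [SilvermanAEC2009] X.4.2(a),
X.4.14; [Miller2011LMS] Def. 1.1; [SchaeferStoll2004].
-/

noncomputable section

open scoped Classical NumberField

open WeierstrassCurve NumberField Literature.NumberTheory.EllipticCurves
  Literature.NumberTheory.EllipticCurves.Rank1Residual
  Literature.NumberTheory.EllipticCurves.Rank1Residual.Typed
  Literature.NumberTheory.EllipticCurves.ModularForms
  Summit.BirchSwinnertonDyer.Rank1Residual.AdditivePotMult

namespace Summit.BirchSwinnertonDyer.Rank1Residual.AdditiveThree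

/-! ### §1 The twist certificate bounds `Ш(E/K)` from below -/

/-- **One exact `3`-Selmer element on the rank-`0` twist gives `ord₃ #Ш(E^{(d_K)}) ≥ 2` and the
splitting `ord₃ #Ш(E/K) = ord₃ #Ш(E) + ord₃ #Ш(E^{(d_K)})`**, for `E/ℚ` with `ρ̄_{E,3}` onto, `K`
imaginary quadratic, `Ш(E/K)` finite (from Kolyvagin or from the structure theorem), `Wd` any
`ℚ`-model of `E^{(d_K)}` with `r_an(Wd) = 0` and `#Sel₃(Wd/ℚ) > 1`: `Wd[3]` is irreducible (twist
transport), so `3 ∤ #Wd(ℚ)_tors` and the element lands in `Ш(Wd)[3] ∖ 0`; Cassels–Tate squares it.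
Per pair; nothing booked. [cite: SilvermanAEC2009, Thm X.4.2(a)]
[cite: SilvermanAEC2009, Thm. X.4.14]
[cite: DokchitserDokchitserAnnals2010, Lemma 4.14] -/
theorem two_le_padicValNat_shaOrder_twist_of_one_lt_card_selmerThree [Fact (Nat.Prime 3)]
    (hCT : exists_casselsTate_pairing (K := ℚ)) (hGZK : rank_eq_analyticRank_of_analyticRank_le_one)
    (W : WeierstrassCurve ℚ) [W.IsElliptic] (K : Type) [Field K] [NumberField K]
    (hK : IsImaginaryQuadratic K) (hfinK : Finite (W.baseChange K).sha)
    (hsurj : W.HasSurjectiveModNGaloisRep 3)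
    (Wd : WeierstrassCurve ℚ) [Wd.IsElliptic]
    (hWd : ∃ C : VariableChange ℚ, C • W.quadraticTwist (NumberField.discr K : ℚ) = Wd)
    (hrd : Wd.analyticRank = 0) (hSel : 1 < Nat.card (Wd.selmerGroup (3 : ℤ))) :
    W.ShaFinite ∧ Wd.ShaFinite ∧ 2 ≤ padicValNat 3 Wd.shaOrder ∧
      padicValNat 3 (W.baseChange K).shaOrder =
        padicValNat 3 W.shaOrder + padicValNat 3 Wd.shaOrder := by
  obtain ⟨C, hC⟩ := hWd
  have hW' : (1 : VariableChange K) • W.baseChange K = W.baseChange K := one_smul _ _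
  haveI : (W.baseChange K).IsElliptic := by rw [WeierstrassCurve.baseChange]; infer_instance
  have hfinK' : (W.baseChange K).ShaFinite := hfinK
  have hfinW : W.ShaFinite := W.shaFinite_of_shaFinite_smul_baseChange K hW' hfinK'
  have hfinD : Wd.ShaFinite := W.shaFinite_twist_of_shaFinite_smul_baseChange K hK.1 hC hW' hfinK'
  have hsum := padicValNat_shaOrder_baseChange W 3 K Wd (W.baseChange K) (by norm_num) hK.1 ⟨C, hC⟩
    ⟨1, hW'⟩ hfinW hfinD hfinK'
  -- `Wd[3]` irreducible, hence no rational `3`-torsion on the twist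
  haveI : NeZero ((3 : ℕ) : ℚ) := ⟨by norm_num⟩
  have hirr : W.HasIrreducibleModPGaloisRep 3 :=
    hasIrreducibleModPGaloisRep_of_hasSurjectiveModNGaloisRep W 3 hsurj
  have hirrd : Wd.HasIrreducibleModPGaloisRep 3 :=
    X11b.hasIrreducibleModPGaloisRep_twist_model W 3 K hK.1 hirr C hC
  have htors : ¬ 3 ∣ Wd.torsionOrder := by
    intro hdvd
    have h0 := padicValNat_torsionOrder_eq_zero_of_irreducible Wd 3 hirrd
    rw [padicValNat.eq_zero_iff] at h0
    rcases h0 with h | h | h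
    · norm_num at h
    · exact Wd.torsionOrder_pos_holds.ne' h
    · exact h hdvd
  -- rank `0` (Gross–Zagier–Kolyvagin) and the Selmer certificate ⟹ `Ш(Wd)[3] ≠ 0` ⟹ `9 ∣ #Ш(Wd)`
  have hrank : Wd.mordellWeilRank = 0 := (hGZK Wd (by rw [hrd]; norm_num)).1.trans hrd
  have htor : ∃ x : Wd.sha, x ≠ 0 ∧ (3 : ℕ) • x = 0 :=
    exists_sha_torsion_of_pow_rank_lt_card_selmerGroup Wd 3 hrank htors
      (by rw [pow_zero]; exact_mod_cast hSel)
  have hdvd : 3 ^ (2 * 1 - 1) ∣ Wd.shaOrder := by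
    simpa using dvd_shaOrder_of_exists_torsion Wd 3 htor
  have hsq : IsSquare Wd.shaOrder := isSquare_shaOrder_of_casselsTate hCT Wd hfinD
  have hn : Wd.shaOrder ≠ 0 := (WeierstrassCurve.shaOrder_pos Wd hfinD).ne'
  have h2 : 2 * 1 ≤ padicValNat 3 Wd.shaOrder :=
    two_mul_le_padicValNat_of_isSquare_of_pow_dvd hsq hn hdvd
  exact ⟨hfinW, hfinD, by omega, hsum⟩

/-! ### §2 `T1⁻` at the pair from the structure shape and the twist certificate -/

/-- **`RKC3Indivisibility` AT THE PAIR, from descent on the twist.** Granted the structure shape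
`KolyvaginStructureThreeShape` (`ord₃ #Ш(E/K) + 2·M_∞ = 2·ord₃ [E(K):ℤP]`), Cassels–Tate and
Gross–Zagier–Kolyvagin: for `E/ℚ` globally minimal with `ρ_{E,3^∞}` onto, `K` Heegner for `N_E`
(`d_K ≠ −3, −4`), `P = y_K` of infinite order, `M_∞ = m`, the census index bound
`ord₃ [E(K):ℤP] ≤ t + 1`, and ONE exact `3`-Selmer element on a `ℚ`-model of the rank-`0` twist:
`M_∞ ≤ t`, i.e. SOME genuine Kolyvagin class is not `3^{t+1}`-divisible — with `t = ord₃ ∏_q c_q(E)`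
this is the conclusion of `RKC3Indivisibility` at `(E, K, Dt, β, ι)`, certified WITHOUT exhibiting a
class and without the divisibility half. Per pair; nothing booked (the census twists lie beyond the
conductor window). [cite: McCallumLMS1991, Thm. 5.4 (p. 288), Thm. 5.8 (p. 290)]
[cite: WZhang2014, §3.8 and Thm. 10.2] [cite: SilvermanAEC2009, Thm. X.4.14] -/
theorem minfty_le_of_structure_of_one_lt_card_selmerThree_twist [Fact (Nat.Prime 3)]
    (hS : KolyvaginStructureThreeShape)
    (hCT : exists_casselsTate_pairing (K := ℚ)) (hGZK : rank_eq_analyticRank_of_analyticRank_le_one)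
    (W : WeierstrassCurve ℚ) [W.IsElliptic] [W.IsGloballyMinimal] (hρ : TowerSurjThree W)
    (K : Type) [Field K] [NumberField K] (hK : IsImaginaryQuadratic K)
    (h3 : NumberField.discr K ≠ -3) (h4 : NumberField.discr K ≠ -4)
    [NeZero (W.conductorNorm ℤ)] (hHN : SatisfiesHeegnerHypothesis (W.conductorNorm ℤ) K)
    (Dt : ModularParametrizationData W (W.conductorNorm ℤ))
    (H : HeegnerDatum (W.conductorNorm ℤ) (NumberField.discr K)) (ι : K →+* ℂ)
    (P : (W.baseChange K).toAffine.Point)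
    (hP : WeierstrassCurve.Affine.Point.map ι.toRatAlgHom P = heegnerPointComplex Dt H)
    (hnt : ¬ IsOfFinAddOrder P)
    (m : ℕ) (hm : MinftyEq W K Dt H.β ι m)
    {t : ℕ} (hI : padicValNat 3 (AddSubgroup.zmultiples P).index ≤ t + 1)
    (Wd : WeierstrassCurve ℚ) [Wd.IsElliptic]
    (hWd : ∃ C : VariableChange ℚ, C • W.quadraticTwist (NumberField.discr K : ℚ) = Wd)
    (hrd : Wd.analyticRank = 0) (hSel : 1 < Nat.card (Wd.selmerGroup (3 : ℤ))) :
    m ≤ t ∧ ¬ MinftyGe W K Dt H.β ι (t + 1) ∧ 2 ≤ padicValNat 3 (W.baseChange K).shaOrder := by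
  obtain ⟨hfinK, hstruct⟩ := hS W hρ K hK h3 h4 hHN Dt H ι P hP hnt m hm
  have hsurj : W.HasSurjectiveModNGaloisRep 3 := by simpa using hρ 1 le_rfl
  obtain ⟨-, -, h2, hsum⟩ := two_le_padicValNat_shaOrder_twist_of_one_lt_card_selmerThree hCT hGZK
    W K hK hfinK hsurj Wd hWd hrd hSel
  have hmt : m ≤ t := by omega
  refine ⟨hmt, fun hge => ?_, by omega⟩
  have := le_of_minftyGe_of_minftyEq W K Dt H.β ι hge hm
  omega

/-- **The same, in the currency of `RKC3Indivisibility`** (`t = ord₃ ∏_q c_q(E)`): on a census pair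
with `ord₃ [E(K):ℤP] ≤ ord₃ ∏_q c_q(E) + 1` (every pair of the o5o6 rank-one census: `s ≤ 1` except
one tame `s = 2` row) the twist certificate gives `¬ M_∞ ≥ ord₃ ∏_q c_q(E) + 1`. [folklore] -/
theorem not_minftyGe_tamagawa_succ_of_structure_of_twist_certificate [Fact (Nat.Prime 3)]
    (hS : KolyvaginStructureThreeShape)
    (hCT : exists_casselsTate_pairing (K := ℚ)) (hGZK : rank_eq_analyticRank_of_analyticRank_le_one)
    (W : WeierstrassCurve ℚ) [W.IsElliptic] [W.IsGloballyMinimal] (hρ : TowerSurjThree W)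
    (K : Type) [Field K] [NumberField K] (hK : IsImaginaryQuadratic K)
    (h3 : NumberField.discr K ≠ -3) (h4 : NumberField.discr K ≠ -4)
    [NeZero (W.conductorNorm ℤ)] (hHN : SatisfiesHeegnerHypothesis (W.conductorNorm ℤ) K)
    (Dt : ModularParametrizationData W (W.conductorNorm ℤ))
    (H : HeegnerDatum (W.conductorNorm ℤ) (NumberField.discr K)) (ι : K →+* ℂ)
    (P : (W.baseChange K).toAffine.Point)
    (hP : WeierstrassCurve.Affine.Point.map ι.toRatAlgHom P = heegnerPointComplex Dt H)
    (hnt : ¬ IsOfFinAddOrder P)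
    (m : ℕ) (hm : MinftyEq W K Dt H.β ι m)
    (hI : padicValNat 3 (AddSubgroup.zmultiples P).index ≤ padicValNat 3 W.tamagawaProduct + 1)
    (Wd : WeierstrassCurve ℚ) [Wd.IsElliptic]
    (hWd : ∃ C : VariableChange ℚ, C • W.quadraticTwist (NumberField.discr K : ℚ) = Wd)
    (hrd : Wd.analyticRank = 0) (hSel : 1 < Nat.card (Wd.selmerGroup (3 : ℤ))) :
    ¬ MinftyGe W K Dt H.β ι (padicValNat 3 W.tamagawaProduct + 1) :=
  (minfty_le_of_structure_of_one_lt_card_selmerThree_twist hS hCT hGZK W hρ K hK h3 h4 hHN Dt H ι P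
    hP hnt m hm hI Wd hWd hrd hSel).2.1

/-! ### §3 With the divisibility half `T1⁺` at the pair: `M_∞ = t`, the `Ш` valuations, `BSD₃` -/

/-- **Slot 2 on a LOCKED census pair needs `T1⁺` only.** Granted the structure shape, Cassels–Tate
and GZK: `T1⁺` at the pair (`M_∞ ≥ t`, `t = ord₃ ∏_q c_q(E)`), the census index EQUALITY
`ord₃ [E(K):ℤP] = t + 1` and the twist certificate give `M_∞ = t` (the full refined conjecture T1 at
the pair), `ord₃ #Ш(E/K) = 2`, `Ш(E)[3^∞] = 0` and `ord₃ #Ш(E^{(d_K)}) = 2`. No `#Sel₉`, no derived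
class, no rank-`0` Iwasawa input. Per pair; nothing booked.
[cite: McCallumLMS1991, Thm. 5.8 (p. 290)] [cite: WZhang2014, Thm. 10.2]
[cite: Jetchev2008, Conj. 1.3] [cite: SilvermanAEC2009, Thm. X.4.14] -/
theorem minftyEq_and_sha_of_structure_of_minftyGe_of_twist_certificate [Fact (Nat.Prime 3)]
    (hS : KolyvaginStructureThreeShape)
    (hCT : exists_casselsTate_pairing (K := ℚ)) (hGZK : rank_eq_analyticRank_of_analyticRank_le_one)
    (W : WeierstrassCurve ℚ) [W.IsElliptic] [W.IsGloballyMinimal] (hρ : TowerSurjThree W)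
    (K : Type) [Field K] [NumberField K] (hK : IsImaginaryQuadratic K)
    (h3 : NumberField.discr K ≠ -3) (h4 : NumberField.discr K ≠ -4)
    [NeZero (W.conductorNorm ℤ)] (hHN : SatisfiesHeegnerHypothesis (W.conductorNorm ℤ) K)
    (Dt : ModularParametrizationData W (W.conductorNorm ℤ))
    (H : HeegnerDatum (W.conductorNorm ℤ) (NumberField.discr K)) (ι : K →+* ℂ)
    (P : (W.baseChange K).toAffine.Point)
    (hP : WeierstrassCurve.Affine.Point.map ι.toRatAlgHom P = heegnerPointComplex Dt H)
    (hnt : ¬ IsOfFinAddOrder P)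
    (ht : MinftyGe W K Dt H.β ι (padicValNat 3 W.tamagawaProduct))
    (m : ℕ) (hm : MinftyEq W K Dt H.β ι m)
    (hI : padicValNat 3 (AddSubgroup.zmultiples P).index = padicValNat 3 W.tamagawaProduct + 1)
    (Wd : WeierstrassCurve ℚ) [Wd.IsElliptic]
    (hWd : ∃ C : VariableChange ℚ, C • W.quadraticTwist (NumberField.discr K : ℚ) = Wd)
    (hrd : Wd.analyticRank = 0) (hSel : 1 < Nat.card (Wd.selmerGroup (3 : ℤ))) :
    MinftyEq W K Dt H.β ι (padicValNat 3 W.tamagawaProduct) ∧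
      padicValNat 3 (W.baseChange K).shaOrder = 2 ∧
      padicValNat 3 W.shaOrder = 0 ∧ padicValNat 3 Wd.shaOrder = 2 := by
  obtain ⟨hfinK, hstruct⟩ := hS W hρ K hK h3 h4 hHN Dt H ι P hP hnt m hm
  have hsurj : W.HasSurjectiveModNGaloisRep 3 := by simpa using hρ 1 le_rfl
  obtain ⟨-, -, h2, hsum⟩ := two_le_padicValNat_shaOrder_twist_of_one_lt_card_selmerThree hCT hGZK
    W K hK hfinK hsurj Wd hWd hrd hSel
  have htm := le_of_minftyGe_of_minftyEq W K Dt H.β ι ht hm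
  have hme : m = padicValNat 3 W.tamagawaProduct := by omega
  subst hme
  exact ⟨hm, by omega, by omega, by omega⟩

/-- **… and the `3`-parts of BSD for BOTH curves**, given the analytic values: `#Ш(E)_an` a `3`-adic
unit (`r_an(E) ≤ 1`) and `ord₃ #Ш(E^{(d_K)})_an = 2` (`r_an = 0`). This is the per-pair content of
`rkc3_reduction_shape`'s assembly with its "rank-`0` `3`-part of the twist" input DISCHARGED by the
twist certificate. Per pair; nothing booked. [cite: Miller2011LMS, §1 and Def. 1.1]
[cite: McCallumLMS1991, Thm. 5.8 (p. 290)] -/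
theorem bsdp_three_pair_of_structure_of_minftyGe_of_twist_certificate [Fact (Nat.Prime 3)]
    (hS : KolyvaginStructureThreeShape)
    (hCT : exists_casselsTate_pairing (K := ℚ)) (hGZK : rank_eq_analyticRank_of_analyticRank_le_one)
    (W : WeierstrassCurve ℚ) [W.IsElliptic] [W.IsGloballyMinimal] (hρ : TowerSurjThree W)
    (K : Type) [Field K] [NumberField K] (hK : IsImaginaryQuadratic K)
    (h3 : NumberField.discr K ≠ -3) (h4 : NumberField.discr K ≠ -4)
    [NeZero (W.conductorNorm ℤ)] (hHN : SatisfiesHeegnerHypothesis (W.conductorNorm ℤ) K)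
    (Dt : ModularParametrizationData W (W.conductorNorm ℤ))
    (H : HeegnerDatum (W.conductorNorm ℤ) (NumberField.discr K)) (ι : K →+* ℂ)
    (P : (W.baseChange K).toAffine.Point)
    (hP : WeierstrassCurve.Affine.Point.map ι.toRatAlgHom P = heegnerPointComplex Dt H)
    (hnt : ¬ IsOfFinAddOrder P)
    (ht : MinftyGe W K Dt H.β ι (padicValNat 3 W.tamagawaProduct))
    (m : ℕ) (hm : MinftyEq W K Dt H.β ι m)
    (hI : padicValNat 3 (AddSubgroup.zmultiples P).index = padicValNat 3 W.tamagawaProduct + 1)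
    (hr : W.analyticRank ≤ 1) {q : ℚ} (hq : shaAn W = (q : ℂ)) (hv : padicValRat 3 q = 0)
    (Wd : WeierstrassCurve ℚ) [Wd.IsElliptic]
    (hWd : ∃ C : VariableChange ℚ, C • W.quadraticTwist (NumberField.discr K : ℚ) = Wd)
    (hrd : Wd.analyticRank = 0) {qd : ℚ} (hqd : shaAn Wd = (qd : ℂ)) (hvd : padicValRat 3 qd = 2)
    (hSel : 1 < Nat.card (Wd.selmerGroup (3 : ℤ))) :
    BSDp W 3 ∧ BSDp Wd 3 := by
  obtain ⟨-, -, hW0, hD2⟩ := minftyEq_and_sha_of_structure_of_minftyGe_of_twist_certificate hS hCT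
    hGZK W hρ K hK h3 h4 hHN Dt H ι P hP hnt ht m hm hI Wd hWd hrd hSel
  refine ⟨bsdp_of_missingPPartAt W 3 hGZK hr ⟨q, hq, ?_⟩,
    bsdp_of_missingPPartAt Wd 3 hGZK (by rw [hrd]; norm_num) ⟨qd, hqd, ?_⟩⟩
  · rw [hv, hW0]; norm_num
  · rw [hvd, hD2]; norm_num

end Summit.BirchSwinnertonDyer.Rank1Residual.AdditiveThree

end
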